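import Literature.Analysis.Fourier.PaleyWienerHalfPlane
import Literature.Analysis.Fourier.TruncatedLaplaceIntegrals
import Mathlib.MeasureTheory.Measure.CharacteristicFunction.Basic

/-!
# One-sided Paley–Wiener for finite measures: half-plane extension of the characteristic
# function forces support in a half-line

Topic `Literature/Analysis/Fourier`. The classical support criterion behind the Paley–Wiener
theorem for the half-plane (Rudin, *Real and complex analysis*, Thm. 19.2 for `H²`; for measures
and distributions: Hörmander, *ALPDO I*, Thm. 7.4.2–7.4.3), in the elementary form needed for
spectral measures:

> if the characteristic function `t ↦ ∫ e^{itω} dρ(ω)` of a finite positive measure `ρ` on `ℝ` is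
> the boundary value of a function `Φ` holomorphic and **bounded** on the open upper half-plane
> `{Im z > 0}` (boundary values taken along vertical lines), then `ρ((-∞,0)) = 0`.

Proof (all folklore): multiply `Φ` by `m(z) = (1 - iz)^{-2}` (holomorphic on `{Im z > -1}`,
`|m(x+iy)| ≤ 1/(1+x²)` for `y ≥ 0`), so that the slices of `G = m Φ` obey the majorant of
`Literature/Analysis/Fourier/PaleyWienerHalfPlane.lean`; hence `𝓕(G(·+iy))(ξ) = 0` for `ξ < 0`,
`y > 0` (`fourier_upperSlice_eq_zero_of_neg`), and letting `y → 0⁺` (dominated convergence)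
`𝓕(G|_ℝ)(ξ) = 0` for `ξ < 0`. Expanding `Φ = ρ̂` and using Fubini, `0 = ∫ K(ω - 2πξ) dρ(ω)` with
`K(s) = ∫ m(x) e^{ixs} dx = 2π θ(-s)`, where `θ(v) = v⁺ e^{-v}` is the density with
`𝓕θ(ξ) = m(-2πξ)` (Fourier inversion, Mathlib's `Continuous.fourierInv_fourier_eq`). Since
`θ(2πξ - ω) > 0` exactly for `ω < 2πξ`, `ρ((-∞, 2πξ)) = 0` for every `ξ < 0`.

* `pwTheta`, `pwMult` — `θ` and `m`; `fourier_pwTheta` (`𝓕θ(ξ) = m(-2πξ)`, via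
  `integral_Ioi_mul_cexp_neg_mul` of `TruncatedLaplaceIntegrals.lean`: `∫₀^∞ v e^{-rv} dv = r^{-2}`),
  `integral_pwMult_mul_cexp` (`∫ m(x) e^{ixs} dx = 2π θ(-s)`);
* **`measure_Iio_eq_zero_of_charFun_eq_boundaryValue`** — the support criterion;
  `measure_Iio_eq_zero_of_charFun_eq_of_continuousAt` — the same with plain continuity of `Φ` at
  real points.
-/

namespace Literature.Analysis.Fourier

open _root_.MeasureTheory Set Filter _root_.Complex
open scoped FourierTransform Real Topology

noncomputable section

/-! ## 1. The test density `θ(v) = v⁺ e^{-v}` and the multiplier `m(z) = (1 - iz)^{-2}` -/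

/-- `θ(v) := v⁺ e^{-v}` (complex-valued). [folklore] -/
def pwTheta (v : ℝ) : ℂ := ((max v 0 * Real.exp (-v) : ℝ) : ℂ)

/-- `m(z) := (1 - iz)^{-2}`. [folklore] -/
def pwMult (z : ℂ) : ℂ := ((1 - I * z) ^ 2)⁻¹

/-- `θ` is continuous. [folklore] -/
theorem continuous_pwTheta : Continuous pwTheta := by
  unfold pwTheta; fun_prop

/-- `θ = 0` on `(-∞, 0]`. [folklore] -/
theorem pwTheta_of_nonpos {v : ℝ} (hv : v ≤ 0) : pwTheta v = 0 := by
  simp [pwTheta, max_eq_right hv]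

/-- `θ(v) = v e^{-v}` on `[0, ∞)`. [folklore] -/
theorem pwTheta_of_nonneg {v : ℝ} (hv : 0 ≤ v) : pwTheta v = ((v * Real.exp (-v) : ℝ) : ℂ) := by
  simp [pwTheta, max_eq_left hv]

/-- `θ > 0` on `(0, ∞)` (as a real number). [folklore] -/
theorem pwTheta_re_pos {v : ℝ} (hv : 0 < v) : 0 < (pwTheta v).re := by
  rw [pwTheta_of_nonneg hv.le, ofReal_re]
  positivity

/-- `t e^{-bt} ≤ (2/b) e^{-bt/2}` for `b > 0` (all real `t`). [folklore] -/
theorem mul_exp_neg_le_exp_half (t : ℝ) {b : ℝ} (hb : 0 < b) :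
    t * Real.exp (-(b * t)) ≤ 2 / b * Real.exp (-(b / 2 * t)) := by
  have h1 : b / 2 * t ≤ Real.exp (b / 2 * t) := by
    have := Real.add_one_le_exp (b / 2 * t)
    linarith
  have h2 : t ≤ 2 / b * Real.exp (b / 2 * t) := by
    rw [div_mul_eq_mul_div, le_div_iff₀ hb]
    nlinarith
  calc t * Real.exp (-(b * t)) ≤ 2 / b * Real.exp (b / 2 * t) * Real.exp (-(b * t)) := by
        gcongr
    _ = 2 / b * Real.exp (-(b / 2 * t)) := by
        rw [mul_assoc, ← Real.exp_add]
        congr 2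
        ring

/-- `‖θ(v)‖ ≤ 2 e^{-v/2}`. [folklore] -/
theorem norm_pwTheta_le (v : ℝ) : ‖pwTheta v‖ ≤ 2 * Real.exp (-(1 / 2 * v)) := by
  rcases le_or_gt v 0 with hv | hv
  · rw [pwTheta_of_nonpos hv, norm_zero]; positivity
  · rw [pwTheta_of_nonneg hv.le, Complex.norm_real, Real.norm_eq_abs, abs_of_nonneg (by positivity)]
    have := mul_exp_neg_le_exp_half v one_pos
    simp only [one_mul, div_one] at this
    exact this

/-- `‖θ(v)‖ ≤ 1`. [folklore] -/
theorem norm_pwTheta_le_one (v : ℝ) : ‖pwTheta v‖ ≤ 1 := by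
  rcases le_or_gt v 0 with hv | hv
  · rw [pwTheta_of_nonpos hv, norm_zero]; exact zero_le_one
  · rw [pwTheta_of_nonneg hv.le, Complex.norm_real, Real.norm_eq_abs, abs_of_nonneg (by positivity)]
    have h1 : v ≤ Real.exp v := by have := Real.add_one_le_exp v; linarith
    rw [Real.exp_neg, mul_inv_le_iff₀ (Real.exp_pos v), one_mul]
    exact h1

/-- `θ` is integrable. [folklore] -/
theorem integrable_pwTheta : Integrable pwTheta := by
  have h1 : IntegrableOn pwTheta (Iic 0) := by
    refine IntegrableOn.congr_fun (f := fun _ => (0 : ℂ)) integrableOn_zero (fun v hv => ?_) measurableSet_Iic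
    exact (pwTheta_of_nonpos hv).symm
  have h2 : IntegrableOn pwTheta (Ioi 0) := by
    refine Integrable.mono' (((exp_neg_integrableOn_Ioi 0 (by norm_num : (0 : ℝ) < 1 / 2)).const_mul 2))
      continuous_pwTheta.aestronglyMeasurable (Eventually.of_forall fun v => ?_)
    have := norm_pwTheta_le v
    rwa [neg_mul] at *
  have := h1.union h2
  rwa [Iic_union_Ioi, integrableOn_univ] at this

/-- `1 - iz ≠ 0` for `Im z > -1` (its real part is `1 + Im z`). [folklore] -/
theorem one_sub_I_mul_ne_zero {z : ℂ} (hz : -1 < z.im) : 1 - I * z ≠ 0 := by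
  intro h
  have : (1 - I * z).re = 1 + z.im := by simp
  rw [h, zero_re] at this
  linarith

/-- `m` is differentiable off `z = -i`, in particular on `{Im z > -1}`. [folklore] -/
theorem differentiableAt_pwMult {z : ℂ} (hz : -1 < z.im) : DifferentiableAt ℂ pwMult z := by
  unfold pwMult
  exact (((differentiableAt_const _).sub (differentiableAt_id.const_mul I)).pow 2).inv
    (pow_ne_zero _ (one_sub_I_mul_ne_zero hz))

/-- `m` is continuous at the points of `{Im z > -1}`. [folklore] -/
theorem continuousAt_pwMult {z : ℂ} (hz : -1 < z.im) : ContinuousAt pwMult z :=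
  (differentiableAt_pwMult hz).continuousAt

/-- `‖m(x+iy)‖ = ((1+y)² + x²)^{-1}`. [folklore] -/
theorem norm_pwMult (x y : ℝ) : ‖pwMult (x + y * I)‖ = ((1 + y) ^ 2 + x ^ 2)⁻¹ := by
  rw [pwMult, norm_inv, norm_pow]
  congr 1
  have h : 1 - I * (x + y * I) = ((1 + y : ℝ) : ℂ) + ((-x : ℝ) : ℂ) * I := by
    push_cast
    ring_nf
    rw [I_sq]
    ring
  rw [h, Complex.norm_add_mul_I, Real.sq_sqrt (by positivity)]
  ring

/-- `‖m(x)‖ = (1 + x²)^{-1}` for real `x`. [folklore] -/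
theorem norm_pwMult_ofReal (x : ℝ) : ‖pwMult x‖ = (1 + x ^ 2)⁻¹ := by
  have := norm_pwMult x 0
  simp only [ofReal_zero, zero_mul, add_zero] at this
  rw [this]
  ring

/-- `‖m(x+iy)‖ ≤ (1 + x²)^{-1}` for `y ≥ 0`. [folklore] -/
theorem norm_pwMult_le {x y : ℝ} (hy : 0 ≤ y) : ‖pwMult (x + y * I)‖ ≤ (1 + x ^ 2)⁻¹ := by
  rw [norm_pwMult]
  exact inv_anti₀ (by positivity) (by nlinarith)

/-- `x ↦ m(x)` is continuous on `ℝ`. [folklore] -/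
theorem continuous_pwMult_ofReal : Continuous fun x : ℝ => pwMult x :=
  continuous_iff_continuousAt.2 fun x =>
    (continuousAt_pwMult (by simp : (-1 : ℝ) < ((x : ℝ) : ℂ).im)).comp continuous_ofReal.continuousAt

/-! ## 2. `𝓕θ = m(-2π·)` and `∫ m(x) e^{ixs} dx = 2π θ(-s)` -/

/-- **`𝓕θ(ξ) = m(-2πξ) = (1 + 2πiξ)^{-2}`**. [folklore] -/
theorem fourier_pwTheta (ξ : ℝ) : 𝓕 pwTheta ξ = pwMult (-(2 * π * ξ)) := by
  rw [Real.fourier_real_eq_integral_exp_smul,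
    ← setIntegral_eq_integral_of_forall_compl_eq_zero (s := Ioi (0 : ℝ)) (fun v hv => by
      rw [pwTheta_of_nonpos (not_lt.1 hv), smul_zero])]
  have heq : ∀ v ∈ Ioi (0 : ℝ), cexp (((-2 * π * v * ξ : ℝ) : ℂ) * I) • pwTheta v =
      (v : ℂ) * cexp (-(1 + 2 * π * ξ * I) * v) := by
    intro v hv
    rw [pwTheta_of_nonneg (le_of_lt hv), smul_eq_mul]
    push_cast
    rw [mul_comm, mul_assoc, ← Complex.exp_add]
    congr 2
    ring
  have ha : 0 < (1 + 2 * π * ξ * I : ℂ).re := by simp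
  have ha0 : (1 + 2 * π * ξ * I : ℂ) ≠ 0 := fun h => by rw [h, zero_re] at ha; exact lt_irrefl _ ha
  rw [setIntegral_congr_fun measurableSet_Ioi heq, integral_Ioi_mul_cexp_neg_mul ha 0, pwMult]
  simp only [ofReal_zero, mul_zero, Complex.exp_zero, add_zero, one_mul, one_div]
  congr 1
  ring

/-- `‖𝓕θ(ξ)‖ ≤ (1 + ξ²)^{-1}`, so `𝓕θ` is integrable. [folklore] -/
theorem integrable_fourier_pwTheta : Integrable (𝓕 pwTheta) := by
  have hc : Continuous (𝓕 pwTheta) :=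
    Literature.Analysis.FunctionSpaces.continuous_fourierIntegral integrable_pwTheta
  refine Integrable.mono' integrable_inv_one_add_sq hc.aestronglyMeasurable (Eventually.of_forall fun ξ => ?_)
  rw [fourier_pwTheta]
  have : (-(2 * (π : ℂ) * ξ)) = ((-(2 * π * ξ) : ℝ) : ℂ) + ((0 : ℝ) : ℂ) * I := by push_cast; ring
  rw [this, norm_pwMult]
  refine inv_anti₀ (by positivity) ?_
  have hπ : 1 ≤ 2 * π := by linarith [Real.two_le_pi]
  nlinarith [sq_nonneg ξ, sq_nonneg (2 * π * ξ), mul_le_mul_of_nonneg_right hπ (sq_nonneg ξ)]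

/-- **Fourier inversion for `θ`**: `θ(-s) = ∫ e^{-2πiηs} m(-2πη) dη`. [folklore] -/
theorem pwTheta_neg_eq_integral (s : ℝ) :
    pwTheta (-s) = ∫ η : ℝ, cexp (((-2 * π * η * s : ℝ) : ℂ) * I) • pwMult (-(2 * π * η)) := by
  have hinv := continuous_pwTheta.fourierInv_fourier_eq integrable_pwTheta integrable_fourier_pwTheta
  have h := congrFun hinv (-s)
  rw [Real.fourierInv_eq_fourier_neg, neg_neg, Real.fourier_real_eq_integral_exp_smul] at h
  rw [← h]
  refine integral_congr_ae (Eventually.of_forall fun η => ?_)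
  simp only [fourier_pwTheta]

/-- **`∫ m(x) e^{ixs} dx = 2π θ(-s)`** (substitute `x = -2πη` in the inversion formula). [folklore] -/
theorem integral_pwMult_mul_cexp (s : ℝ) :
    ∫ x : ℝ, pwMult x * cexp ((x : ℂ) * s * I) = 2 * π * pwTheta (-s) := by
  set g : ℝ → ℂ := fun x => pwMult x * cexp ((x : ℂ) * s * I) with hg
  have hsub := Measure.integral_comp_mul_left g (-(2 * π))
  -- `g(-2πη)` is the integrand of the inversion formula
  have heq : (fun η : ℝ => g (-(2 * π) * η)) = fun η : ℝ => cexp (((-2 * π * η * s : ℝ) : ℂ) * I) • pwMult (-(2 * π * η)) := by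
    funext η
    rw [hg]
    simp only [smul_eq_mul]
    rw [mul_comm (cexp _)]
    congr 1
    · congr 1; push_cast; ring
    · congr 1; push_cast; ring
  rw [heq, ← pwTheta_neg_eq_integral] at hsub
  have h2π : |(-(2 * π))⁻¹| = (2 * π)⁻¹ := by
    rw [abs_inv, abs_neg, abs_of_pos Real.two_pi_pos]
  rw [h2π] at hsub
  change pwTheta (-s) = ((2 * π)⁻¹ : ℝ) • ∫ x : ℝ, g x at hsub
  rw [hsub, Complex.real_smul]
  push_cast
  field_simp

/-! ## 3. The support criterion -/

variable {ρ : Measure ℝ} [IsFiniteMeasure ρ] {Φ : ℂ → ℂ} {B : ℝ}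

/-- A bound valid on the open upper half-plane is non-negative. [folklore] -/
theorem nonneg_of_upperHalfPlaneBound (hb : ∀ z : ℂ, 0 < z.im → ‖Φ z‖ ≤ B) : 0 ≤ B :=
  (norm_nonneg _).trans (hb I (by simp))

/-- **Step 1–2**: for `ξ < 0`, the Fourier transform of `x ↦ m(x) Φ(x)` vanishes at `ξ` (the slices
`𝓕((mΦ)(·+iy))(ξ)` vanish by `fourier_upperSlice_eq_zero_of_neg`, and `y → 0⁺` by dominated
convergence). [folklore] -/
theorem fourier_pwMult_mul_eq_zero (hd : ∀ z : ℂ, 0 < z.im → DifferentiableAt ℂ Φ z)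
    (hb : ∀ z : ℂ, 0 < z.im → ‖Φ z‖ ≤ B)
    (hc : ∀ x : ℝ, Tendsto (fun y : ℝ => Φ (x + y * I)) (𝓝[>] 0) (𝓝 (Φ x)))
    {ξ : ℝ} (hξ : ξ < 0) : 𝓕 (fun x : ℝ => pwMult x * Φ x) ξ = 0 := by
  have hB := nonneg_of_upperHalfPlaneBound hb
  set G : ℂ → ℂ := fun z => pwMult z * Φ z with hG
  have hGd : ∀ z : ℂ, 0 < z.im → DifferentiableAt ℂ G z := fun z hz =>
    (differentiableAt_pwMult (by linarith)).mul (hd z hz)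
  have hGb : ∀ x y : ℝ, 0 < y → ‖G (x + y * I)‖ ≤ B * (1 + y) ^ 0 / (1 + x ^ 2) := by
    intro x y hy
    rw [hG, pow_zero, mul_one, div_eq_mul_inv]
    simp only
    rw [norm_mul, mul_comm]
    exact mul_le_mul (hb _ (by simpa using hy)) (norm_pwMult_le hy.le) (norm_nonneg _) hB
  -- the slices have vanishing Fourier transform at `ξ`
  have hslice : ∀ y : ℝ, 0 < y → 𝓕 (fun x : ℝ => G (x + y * I)) ξ = 0 := fun y hy =>
    fourier_upperSlice_eq_zero_of_neg hGd hGb hy hξ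
  -- `y_n = 1/(n+1) → 0⁺`
  set yn : ℕ → ℝ := fun n => 1 / ((n : ℝ) + 1) with hyn
  have hyn_pos : ∀ n, 0 < yn n := fun n => by rw [hyn]; positivity
  have hyn_lim : Tendsto yn atTop (𝓝[>] 0) := by
    refine tendsto_nhdsWithin_iff.2 ⟨tendsto_one_div_add_atTop_nhds_zero_nat, Eventually.of_forall hyn_pos⟩
  -- dominated convergence for the Fourier integrals
  set Fn : ℕ → ℝ → ℂ := fun n x => cexp (((-2 * π * x * ξ : ℝ) : ℂ) * I) • G (x + yn n * I) with hFn
  set F : ℝ → ℂ := fun x => cexp (((-2 * π * x * ξ : ℝ) : ℂ) * I) • G x with hF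
  have hker : ∀ x : ℝ, ‖cexp (((-2 * π * x * ξ : ℝ) : ℂ) * I)‖ = 1 := fun x => Complex.norm_exp_ofReal_mul_I _
  have h_meas : ∀ n, AEStronglyMeasurable (Fn n) volume := by
    intro n
    refine (Continuous.aestronglyMeasurable ?_)
    exact (by fun_prop : Continuous fun x : ℝ => cexp (((-2 * π * x * ξ : ℝ) : ℂ) * I)).smul
      (continuous_upperSlice hGd (hyn_pos n))
  have h_bound : ∀ n, ∀ᵐ x ∂(volume : Measure ℝ), ‖Fn n x‖ ≤ B * (1 + x ^ 2)⁻¹ := by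
    intro n
    refine Eventually.of_forall fun x => ?_
    rw [hFn]
    simp only
    rw [norm_smul, hker, one_mul]
    have := hGb x (yn n) (hyn_pos n)
    rwa [pow_zero, mul_one, div_eq_mul_inv] at this
  have h_lim : ∀ᵐ x ∂(volume : Measure ℝ), Tendsto (fun n => Fn n x) atTop (𝓝 (F x)) := by
    refine Eventually.of_forall fun x => ?_
    rw [hFn, hF]
    refine Tendsto.smul tendsto_const_nhds ?_
    -- `G(x + i y_n) → G(x)`
    have h1 : Tendsto (fun n => ((x : ℂ) + yn n * I)) atTop (𝓝 (x : ℂ)) := by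
      have : Tendsto (fun y : ℝ => ((x : ℂ) + y * I)) (𝓝 0) (𝓝 ((x : ℂ) + (0 : ℝ) * I)) :=
        ((continuous_const.add (continuous_ofReal.mul continuous_const)).tendsto 0)
      simp only [ofReal_zero, zero_mul, add_zero] at this
      exact this.comp (tendsto_nhdsWithin_iff.1 hyn_lim).1
    have h2 : Tendsto (fun n => pwMult ((x : ℂ) + yn n * I)) atTop (𝓝 (pwMult x)) :=
      ((continuousAt_pwMult (by simp : (-1 : ℝ) < (x : ℂ).im)).tendsto).comp h1
    have h3 : Tendsto (fun n => Φ ((x : ℂ) + yn n * I)) atTop (𝓝 (Φ x)) := (hc x).comp hyn_lim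
    exact h2.mul h3
  have hdct := tendsto_integral_of_dominated_convergence (fun x : ℝ => B * (1 + x ^ 2)⁻¹) h_meas
    (integrable_inv_one_add_sq.const_mul B) h_bound h_lim
  -- each term of the sequence is `0`
  have hzero : ∀ n, ∫ x, Fn n x = 0 := by
    intro n
    rw [← hslice (yn n) (hyn_pos n), Real.fourier_real_eq_integral_exp_smul]
  simp only [hzero] at hdct
  rw [Real.fourier_real_eq_integral_exp_smul]
  exact tendsto_nhds_unique tendsto_const_nhds hdct |>.symm

/-- **Step 3**: Fubini — `𝓕(m ρ̂)(ξ) = ∫ 2π θ(2πξ - ω) dρ(ω)`. [folklore] -/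
theorem fourier_pwMult_mul_charFun (ρ : Measure ℝ) [IsFiniteMeasure ρ] (ξ : ℝ) :
    𝓕 (fun x : ℝ => pwMult x * charFun ρ x) ξ = ∫ ω, 2 * π * pwTheta (2 * π * ξ - ω) ∂ρ := by
  rw [Real.fourier_real_eq_integral_exp_smul]
  -- the joint integrand
  set f : ℝ → ℝ → ℂ := fun x ω => cexp (((-2 * π * x * ξ : ℝ) : ℂ) * I) * pwMult x * cexp ((x : ℂ) * ω * I)
    with hf
  have hker : ∀ x : ℝ, ‖cexp (((-2 * π * x * ξ : ℝ) : ℂ) * I)‖ = 1 := fun x => Complex.norm_exp_ofReal_mul_I _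
  have hker2 : ∀ x ω : ℝ, ‖cexp ((x : ℂ) * ω * I)‖ = 1 := fun x ω => by
    rw [show (x : ℂ) * ω * I = ((x * ω : ℝ) : ℂ) * I by push_cast; ring]
    exact Complex.norm_exp_ofReal_mul_I _
  have hnorm : ∀ x ω : ℝ, ‖f x ω‖ = (1 + x ^ 2)⁻¹ := by
    intro x ω
    rw [hf]
    simp only
    rw [norm_mul, norm_mul, hker, hker2, one_mul, mul_one, norm_pwMult_ofReal]
  have hcont : Continuous (Function.uncurry f) := by
    rw [hf]
    exact Continuous.mul (Continuous.mul (by fun_prop) (continuous_pwMult_ofReal.comp continuous_fst)) (by fun_prop)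
  have hint : Integrable (Function.uncurry f) ((volume : Measure ℝ).prod ρ) := by
    refine (integrable_prod_iff hcont.aestronglyMeasurable).2 ⟨Eventually.of_forall fun x => ?_, ?_⟩
    · refine Integrable.mono' (integrable_const ((1 + x ^ 2)⁻¹)) ?_ (Eventually.of_forall fun ω => (hnorm x ω).le)
      exact (hcont.comp (Continuous.prodMk_right x)).aestronglyMeasurable
    · have : (fun x : ℝ => ∫ ω, ‖Function.uncurry f (x, ω)‖ ∂ρ) = fun x => ρ.real univ * (1 + x ^ 2)⁻¹ := by
        funext x
        simp only [Function.uncurry_apply_pair, hnorm, integral_const, smul_eq_mul]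
      rw [this]
      exact integrable_inv_one_add_sq.const_mul _
  -- rewrite the Fourier integrand as an inner integral and swap
  have hinner : ∀ x : ℝ, cexp (((-2 * π * x * ξ : ℝ) : ℂ) * I) • (pwMult x * charFun ρ x) = ∫ ω, f x ω ∂ρ := by
    intro x
    rw [charFun_apply_real, ← integral_const_mul, smul_eq_mul, ← integral_const_mul]
    refine integral_congr_ae (Eventually.of_forall fun ω => ?_)
    rw [hf]
    simp only
    ring
  simp_rw [hinner]
  rw [integral_integral_swap hint]
  refine integral_congr_ae (Eventually.of_forall fun ω => ?_)
  show ∫ x, f x ω = 2 * π * pwTheta (2 * π * ξ - ω)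
  -- the inner `x`-integral is `∫ m(x) e^{ix(ω - 2πξ)} dx = 2π θ(2πξ - ω)`
  have : (fun x : ℝ => f x ω) = fun x : ℝ => pwMult x * cexp ((x : ℂ) * ((ω - 2 * π * ξ : ℝ) : ℂ) * I) := by
    funext x
    rw [hf]
    simp only
    rw [mul_comm (cexp _) (pwMult _), mul_assoc, ← Complex.exp_add]
    congr 2
    push_cast
    ring
  rw [this, integral_pwMult_mul_cexp, neg_sub]

/-- **Step 4**: if `∫ θ(-c - ω) dρ(ω) = 0` then `ρ((-∞,-c)) = 0` (`θ > 0` on `(0,∞)`). [folklore] -/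
theorem measure_Iio_neg_eq_zero_of_integral_pwTheta (ρ : Measure ℝ) [IsFiniteMeasure ρ] {c : ℝ}
    (h : ∫ ω, pwTheta (-c - ω) ∂ρ = 0) : ρ (Iio (-c)) = 0 := by
  set g : ℝ → ℝ := fun ω => max (-c - ω) 0 * Real.exp (-(-c - ω)) with hg
  have hgθ : ∀ ω, pwTheta (-c - ω) = ((g ω : ℝ) : ℂ) := fun ω => rfl
  have hg_cont : Continuous g := by rw [hg]; fun_prop
  have hg_nonneg : 0 ≤ g := fun ω => by rw [hg]; positivity
  have hg_le : ∀ ω, ‖g ω‖ ≤ 1 := fun ω => by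
    have := norm_pwTheta_le_one (-c - ω)
    rwa [hgθ, Complex.norm_real] at this
  have hg_int : Integrable g ρ :=
    Integrable.mono' (integrable_const 1) hg_cont.aestronglyMeasurable (Eventually.of_forall hg_le)
  have hint0 : ∫ ω, g ω ∂ρ = 0 := by
    simp_rw [hgθ] at h
    have h' : ((∫ ω, g ω ∂ρ : ℝ) : ℂ) = 0 := by rw [← h]; exact integral_ofReal.symm
    exact_mod_cast h'
  have hae := (integral_eq_zero_iff_of_nonneg hg_nonneg hg_int).1 hint0
  -- `g > 0` on `(-∞, -c)`
  have hsub : Iio (-c) ⊆ {ω | g ω ≠ 0} := by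
    intro ω hω
    have hω' : 0 < -c - ω := by rw [mem_Iio] at hω; linarith
    have : 0 < g ω := by
      rw [hg]
      simp only
      rw [max_eq_left hω'.le]
      positivity
    exact this.ne'
  refine measure_mono_null hsub ?_
  have : {ω | g ω ≠ 0} = {ω | ¬ g ω = (0 : ℝ → ℝ) ω} := rfl
  rw [this]
  exact ae_iff.1 hae

/-- **One-sided Paley–Wiener for finite measures.** If the characteristic function
`t ↦ ∫ e^{itω} dρ(ω)` of a finite measure `ρ` on `ℝ` is the boundary value (along vertical lines)
of a function `Φ` holomorphic and bounded on the open upper half-plane, then `ρ((-∞, 0)) = 0`.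
[folklore] -/
theorem measure_Iio_eq_zero_of_charFun_eq_boundaryValue (hd : ∀ z : ℂ, 0 < z.im → DifferentiableAt ℂ Φ z)
    (hb : ∀ z : ℂ, 0 < z.im → ‖Φ z‖ ≤ B)
    (hc : ∀ x : ℝ, Tendsto (fun y : ℝ => Φ (x + y * I)) (𝓝[>] 0) (𝓝 (Φ x)))
    (hρ : ∀ t : ℝ, charFun ρ t = Φ t) : ρ (Iio 0) = 0 := by
  -- `ρ((-∞,-c)) = 0` for every `c > 0`
  have hneg : ∀ c : ℝ, 0 < c → ρ (Iio (-c)) = 0 := by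
    intro c hc0
    refine measure_Iio_neg_eq_zero_of_integral_pwTheta ρ ?_
    have hξ : -c / (2 * π) < 0 := div_neg_of_neg_of_pos (neg_lt_zero.2 hc0) Real.two_pi_pos
    have h0 := fourier_pwMult_mul_eq_zero hd hb hc hξ
    have hfun : (fun x : ℝ => pwMult x * Φ x) = fun x : ℝ => pwMult x * charFun ρ x := by
      funext x; rw [hρ x]
    rw [hfun, fourier_pwMult_mul_charFun, integral_const_mul, mul_eq_zero] at h0
    rcases h0 with h0 | h0
    · exfalso
      have : (2 * (π : ℂ)) ≠ 0 := by exact_mod_cast Real.two_pi_pos.ne'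
      exact this h0
    · rw [← h0]
      refine integral_congr_ae (Eventually.of_forall fun ω => ?_)
      field_simp
  -- exhaust `(-∞, 0)` by `(-∞, -1/(n+1))`
  have hcover : Iio (0 : ℝ) ⊆ ⋃ n : ℕ, Iio (-(1 / ((n : ℝ) + 1))) := by
    intro ω hω
    rw [mem_Iio] at hω
    obtain ⟨n, hn⟩ := exists_nat_one_div_lt (neg_pos.2 hω)
    exact mem_iUnion.2 ⟨n, by rw [mem_Iio]; linarith⟩
  refine measure_mono_null hcover (measure_iUnion_null fun n => hneg _ (by positivity))

/-- **One-sided Paley–Wiener for finite measures**, with plain continuity of `Φ` at the real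
points (e.g. `Φ` holomorphic on a neighbourhood of the closed upper half-plane). [folklore] -/
theorem measure_Iio_eq_zero_of_charFun_eq_of_continuousAt (hd : ∀ z : ℂ, 0 < z.im → DifferentiableAt ℂ Φ z)
    (hb : ∀ z : ℂ, 0 < z.im → ‖Φ z‖ ≤ B) (hc : ∀ x : ℝ, ContinuousAt Φ x)
    (hρ : ∀ t : ℝ, charFun ρ t = Φ t) : ρ (Iio 0) = 0 := by
  refine measure_Iio_eq_zero_of_charFun_eq_boundaryValue hd hb (fun x => ?_) hρ
  have h1 : Tendsto (fun y : ℝ => ((x : ℂ) + y * I)) (𝓝[>] 0) (𝓝 (x : ℂ)) := by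
    have : Tendsto (fun y : ℝ => ((x : ℂ) + y * I)) (𝓝 0) (𝓝 ((x : ℂ) + (0 : ℝ) * I)) :=
      ((continuous_const.add (continuous_ofReal.mul continuous_const)).tendsto 0)
    simp only [ofReal_zero, zero_mul, add_zero] at this
    exact this.mono_left nhdsWithin_le_nhds
  exact (hc x).tendsto.comp h1

end

end Literature.Analysis.Fourier
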